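import Literature.NumberTheory.Automorphic.Liu2021.AppendixC.Glue
import Literature.AlgebraicGeometry.Motives.JacobianGaloisDescent
import Mathlib.AlgebraicGeometry.PullbackCarrier
import Mathlib.AlgebraicGeometry.Morphisms.Finite
import HarnessLib

/-!
# Liu 2021 §2.1, proof of the Proposition: «`(∇X)_{k'} ≃ ∇_{k'}X'`» — Galois descent of `∇X`

[Liu2021] = Yifeng Liu, *Fourier–Jacobi cycles and arithmetic relative trace formula*, Camb. J. Math.
**9** (2021) = arXiv:2102.11518, §2.1 Def. 2.1 (1) (FJcycle.tex l. 1174): «We denote by `∇X` the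
smallest open and closed subscheme of `X × X` containing the diagonal `ΔX`» — typed in
`Liu2021/AppendixC/Glue.lean` as the CARRIER structure `AppendixC.Nabla X` (a clopen subscheme of
`X × X` through which the diagonal factors, minimal among such).  The printed proof of the Proposition
(existence of the Albanese variety, l. 1194–1200) constructs `∇` and the Albanese datum over a
separable closure `k'` and descends: «As `(∇X)_{k'} ≃ ∇_{k'}X'`, the statement for `X` then follows by
Galois descent.»  THIS FILE supplies the `∇`-half of that sentence for a finite Galois extension
`L / k` (PROOF FILE: theorems only, no definition, no named fact, sorry-free):

* `GaloisDescent.exists_gal_apply_eq` — the Galois group is TRANSITIVE on the fibres of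
  `Y ×_k L → Y` (pointwise form of `Y_L ×_Y Y_L ≅ Γ × Y_L`, Görtz–Wedhorn I Def. 14.84; from the
  field-valued version `GaloisDescent.exists_eq_comp_gal` of `Motives/JacobianGaloisDescent`).
* `GaloisDescent.preimage_image_fst_eq` — a Galois-stable subset of `Y ×_k L` is the preimage of its
  image in `Y` (descent of Galois-stable subsets).
* `GaloisDescent.isPullback_bcFunctor_map_left`, `range_bcFunctor_map_left` — `g_L : X_L → Y_L` is
  the base change of `g` (so open / closed immersions stay such, and `im g_L = pr⁻¹(im g)`).
* `Nabla.exists_of_isClopen` — a clopen subset of `X × X` containing `ΔX` and contained in every clopen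
  subscheme containing `ΔX` IS a `∇X` (constructor for the carrier structure).
* `Nabla.exists_of_nabla_baseChange` — **for a `k`-scheme `X` and a finite Galois `L / k`, every
  `∇(X_L)` (Def. 2.1 (1) for `X_L = X ×_k L`) descends: there is a `∇X` over `k`, `N`, with an
  isomorphism `N ×_k L ≅ ∇(X_L)` of `L`-schemes carrying the base-changed diagonal `(ΔX)_L` to
  `Δ(X_L)`** — Liu's «`(∇X)_{k'} ≃ ∇_{k'}X'`».  Proof: the clopen `∇(X_L) ⊆ (X × X)_L` is Galois-STABLE
  (each Galois translate is again a clopen `L`-subscheme containing the diagonal, so it contains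
  `∇(X_L)` by minimality), hence is the preimage of its image `W₀ ⊆ X × X` under the finite surjection
  `(X × X)_L → X × X` (transitivity), and `W₀` is clopen (closed map; its complement is the image of
  the complement); `∇X := (X × X)|_{W₀}` contains `ΔX`, and is minimal because the base change of any
  clopen `k`-subscheme containing `ΔX` contains `∇(X_L)`.

Use (cell pub-hodgecm2, TEAM hComp, row A0-DECITE): with `Albanese.nonempty_of_albanese_baseChange`
(Galois descent of the Albanese datum) and `Albanese.nonempty_of_isColimit` (the split case) this
de-cites the named fact `Liu2021.exists_albanese` at the consumer `AppendixC.Sec42Data` (`X_K` smooth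
projective over the CM field `E ⊆ ℂ`).  HC_CM is NOT proved; nothing here discharges any COR-CM binder.

Relies on: nothing unproved (axioms `propext`, `Classical.choice`, `Quot.sound`).

## References

* [Liu2021] Y. Liu, arXiv:2102.11518 = Camb. J. Math. 9 (2021), §2.1 Def. 2.1 (1) (FJcycle.tex
  l. 1171–1174), Proposition (l. 1190–1192) with proof (l. 1194–1200).
* [GortzWedhorn2020] U. Görtz, T. Wedhorn, *Algebraic Geometry I*, 2nd ed. (2020), Prop. 4.16,
  §(14.20), Def. 14.84, Thm. 14.83 (Galois descent; transitivity on fibres).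
-/

noncomputable section

open CategoryTheory CategoryTheory.Limits AlgebraicGeometry MonoidalCategory CartesianMonoidalCategory

universe u

/-! ### Galois-stable subsets of `Y ×_k L` descend; base change of immersions -/

namespace Literature.AlgebraicGeometry.Motives.GaloisDescent

open AbelianVariety (bcSpec bcFunctor specAut)

set_option backward.isDefEq.respectTransparency false

variable {k : Type u} [Field k] (L : Type u) [Field L] [Algebra k L]

/-- Pointwise form of an equation of composites: `g (f a) = h a` if `f ≫ g = h` (private helper). [folklore] -/
private theorem apply_apply_of_comp_eq {A B C : Scheme.{u}} {f : A ⟶ B} {g : B ⟶ C} {h : A ⟶ C}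
    (e : f ≫ g = h) (a : ↥A) : g (f a) = h a := by
  rw [← e, Scheme.Hom.comp_apply]

/-- The image of a composite is contained in the image of the second map (private helper). [folklore] -/
private theorem range_comp_subset_range {A B C : Scheme.{u}} (f : A ⟶ B) (g : B ⟶ C) :
    Set.range ⇑(f ≫ g) ⊆ Set.range ⇑g := by
  rintro _ ⟨a, rfl⟩
  exact ⟨f a, (Scheme.Hom.comp_apply f g a).symm⟩

section Transitive

variable [Normal k L] (Y : SchemeOver k)

/-- **The Galois group is transitive on the fibres of `pr : Y ×_k L → Y`** (`L / k` normal): two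
points `y`, `w` of `Y_L` with the same image in `Y` satisfy `y = (1 × Spec γ⁻¹)(w)` for some
`γ ∈ Aut(L/k)`.  Pointwise form of `Y_L ×_Y Y_L ≅ Γ × Y_L` (Görtz–Wedhorn I, Def. 14.84), deduced from
the field-valued version `exists_eq_comp_gal`: the residue field `κ(t)` of a point `t` of
`Y_L ×_Y Spec κ(y)` over `w` carries a `κ(t)`-point through `y` and one through `w` with the same
image in `Y`. [cite: GortzWedhorn2020, Def. 14.84 and §(14.20)] -/
theorem exists_gal_apply_eq (y w : ↥(bc L Y))
    (h : pullback.fst Y.hom (bcSpec k L) y = pullback.fst Y.hom (bcSpec k L) w) :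
    ∃ γ : L ≃ₐ[k] L, gal L Y γ w = y := by
  -- a point `t` of `Y_L ×_Y Spec κ(y)` over `w`
  have hw : w ∈ Set.range ⇑(pullback.fst (pullback.fst Y.hom (bcSpec k L))
      ((bc L Y).fromSpecResidueField y ≫ pullback.fst Y.hom (bcSpec k L))) := by
    rw [Scheme.Pullback.range_fst]
    refine ⟨default, ?_⟩
    rw [Scheme.Hom.comp_apply, Scheme.fromSpecResidueField_apply, h]
  obtain ⟨t, ht⟩ := hw
  -- the two `κ(t)`-points of `Y_L`, through `y` and through `w`, agree in `Y`
  obtain ⟨γ, hγ⟩ := exists_eq_comp_gal L Y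
    ((pullback (pullback.fst Y.hom (bcSpec k L))
        ((bc L Y).fromSpecResidueField y ≫ pullback.fst Y.hom (bcSpec k L))).fromSpecResidueField t ≫
      pullback.snd _ _ ≫ (bc L Y).fromSpecResidueField y)
    ((pullback (pullback.fst Y.hom (bcSpec k L))
        ((bc L Y).fromSpecResidueField y ≫ pullback.fst Y.hom (bcSpec k L))).fromSpecResidueField t ≫
      pullback.fst _ _)
    (by simp only [Category.assoc]; rw [pullback.condition])
  refine ⟨γ, ?_⟩
  obtain ⟨s⟩ : Nonempty ↥(Spec ((pullback (pullback.fst Y.hom (bcSpec k L))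
      ((bc L Y).fromSpecResidueField y ≫ pullback.fst Y.hom (bcSpec k L))).residueField t)) := ⟨default⟩
  have e1 := congrArg (fun φ : _ ⟶ bc L Y => φ s) hγ
  simp only [Scheme.Hom.comp_apply, Scheme.fromSpecResidueField_apply, ht] at e1
  exact e1.symm

/-- **A Galois-stable subset of `Y ×_k L` is the preimage of its image in `Y`** (descent of
Galois-stable subsets along `pr : Y_L → Y`, by transitivity of the Galois group on the fibres).
[cite: GortzWedhorn2020, §(14.20) and Def. 14.84] -/
theorem preimage_image_fst_eq (W : Set ↥(bc L Y)) (hW : ∀ γ : L ≃ₐ[k] L, Set.MapsTo ⇑(gal L Y γ) W W) :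
    ⇑(pullback.fst Y.hom (bcSpec k L)) ⁻¹' (⇑(pullback.fst Y.hom (bcSpec k L)) '' W) = W := by
  refine Set.Subset.antisymm ?_ (Set.subset_preimage_image _ _)
  rintro y ⟨w, hw, hwy⟩
  obtain ⟨γ, hγ⟩ := exists_gal_apply_eq L Y y w hwy.symm
  rw [← hγ]
  exact hW γ hw

end Transitive

section BaseChange

variable {X Y : SchemeOver k} (g : X ⟶ Y)

/-- `g_L` commutes with the projections: `g_L ≫ pr_Y = pr_X ≫ g` (the base-change square of a
`K`-morphism, Görtz–Wedhorn I, Prop. 4.16). [cite: GortzWedhorn2020, Prop. 4.16] -/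
@[reassoc]
theorem bcFunctor_map_left_comp_fst :
    ((bcFunctor k L).map g).left ≫ pullback.fst Y.hom (bcSpec k L) =
      pullback.fst X.hom (bcSpec k L) ≫ g.left :=
  pullback.lift_fst _ _ _

/-- **`g_L : X_L → Y_L` is the base change of `g : X → Y`**: the square over `g` with the projections
`X_L → X`, `Y_L → Y` is cartesian (pasting of the cartesian squares defining `X_L` and `Y_L`;
Görtz–Wedhorn I, Prop. 4.16). [cite: GortzWedhorn2020, Prop. 4.16] -/
theorem isPullback_bcFunctor_map_left :
    IsPullback ((bcFunctor k L).map g).left (pullback.fst X.hom (bcSpec k L))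
      (pullback.fst Y.hom (bcSpec k L)) g.left := by
  refine IsPullback.of_right ?_ (bcFunctor_map_left_comp_fst L g)
    (IsPullback.of_hasPullback Y.hom (bcSpec k L)).flip
  have h2 : ((bcFunctor k L).map g).left ≫ pullback.snd Y.hom (bcSpec k L) =
      pullback.snd X.hom (bcSpec k L) := pullback.lift_snd _ _ _
  rw [h2, Over.w g]
  exact (IsPullback.of_hasPullback X.hom (bcSpec k L)).flip

/-- Open immersions stay open immersions after extension of the base field (Görtz–Wedhorn I,
Prop. 4.32: immersions are stable under base change). [cite: GortzWedhorn2020, Prop. 4.32] -/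
theorem isOpenImmersion_bcFunctor_map_left [IsOpenImmersion g.left] :
    IsOpenImmersion ((bcFunctor k L).map g).left :=
  MorphismProperty.of_isPullback (P := @IsOpenImmersion) (isPullback_bcFunctor_map_left L g).flip ‹_›

/-- Closed immersions stay closed immersions after extension of the base field (Görtz–Wedhorn I,
Prop. 4.32). [cite: GortzWedhorn2020, Prop. 4.32] -/
theorem isClosedImmersion_bcFunctor_map_left [IsClosedImmersion g.left] :
    IsClosedImmersion ((bcFunctor k L).map g).left :=
  MorphismProperty.of_isPullback (P := @IsClosedImmersion) (isPullback_bcFunctor_map_left L g).flip ‹_›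

/-- **The image of `g_L` is the preimage of the image of `g`** under `pr : Y_L → Y` (the underlying
set of a fibre product, Mathlib `Scheme.Pullback.range_fst`). [cite: GortzWedhorn2020, Prop. 4.16 and Lemma 4.28] -/
theorem range_bcFunctor_map_left :
    Set.range ⇑((bcFunctor k L).map g).left =
      ⇑(pullback.fst Y.hom (bcSpec k L)) ⁻¹' Set.range ⇑g.left := by
  have hsq := isPullback_bcFunctor_map_left L g
  have hinv : hsq.isoPullback.inv ≫ ((bcFunctor k L).map g).left =
      pullback.fst (pullback.fst Y.hom (bcSpec k L)) g.left :=
    hsq.isoPullback.inv_comp_eq.mpr hsq.isoPullback_hom_fst.symm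
  refine Set.Subset.antisymm ?_ ?_
  · rintro _ ⟨t, rfl⟩
    exact ⟨pullback.fst X.hom (bcSpec k L) t,
      (apply_apply_of_comp_eq (bcFunctor_map_left_comp_fst L g) t).symm⟩
  · intro z hz
    rw [← Scheme.Pullback.range_fst] at hz
    obtain ⟨s, rfl⟩ := hz
    exact ⟨hsq.isoPullback.inv s, apply_apply_of_comp_eq hinv s⟩

end BaseChange

end Literature.AlgebraicGeometry.Motives.GaloisDescent

/-! ### `∇X`: a constructor, Galois stability of `∇(X_L)`, and descent -/

open Literature.AlgebraicGeometry.Motives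

namespace Literature.NumberTheory.Automorphic.Liu2021.AppendixC

namespace Nabla

open AbelianVariety (bcSpec bcFunctor specAut)

set_option backward.isDefEq.respectTransparency false

section Constructor

variable {K : Type u} [Field K] (X : SchemeOver K)

/-- **A clopen subset of `X × X` containing the diagonal and contained in every clopen subscheme
containing the diagonal is a `∇X`** (Def. 2.1 (1): «the smallest open and closed subscheme of `X × X`
containing the diagonal `ΔX`»): the open subscheme `(X × X)|_{W₀}` with its inclusion, the diagonal
lifted through it (`IsOpenImmersion.lift`), and minimality by lifting through the given clopen
immersions.  Constructor for the carrier structure `Nabla`. [cite: Liu2021, §2.1 Def. 2.1 (1), l. 1171–1174] -/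
theorem exists_of_isClopen (W₀ : Set ↥(X ⊗ X).left) (hW₀ : IsClopen W₀)
    (hΔ : Set.range ⇑(lift (𝟙 X) (𝟙 X)).left ⊆ W₀)
    (hmin : ∀ (W : SchemeOver K) (j : W ⟶ X ⊗ X), IsOpenImmersion j.left → IsClosedImmersion j.left →
      (∃ δ : X ⟶ W, δ ≫ j = lift (𝟙 X) (𝟙 X)) → W₀ ⊆ Set.range ⇑j.left) :
    ∃ N : Nabla X, Set.range ⇑N.incl.left = W₀ := by
  let U : (X ⊗ X).left.Opens := ⟨W₀, hW₀.2⟩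
  have hrange : Set.range ⇑U.ι = W₀ := Scheme.Opens.range_ι U
  haveI hUc : IsClosedImmersion U.ι :=
    IsClosedImmersion.of_isPreimmersion _ (by simpa only [hrange] using hW₀.1)
  have hΔ' : Set.range ⇑(lift (𝟙 X) (𝟙 X)).left ⊆ Set.range ⇑U.ι := hΔ.trans hrange.symm.subset
  obtain ⟨dX, hfac⟩ : ∃ dX : X.left ⟶ U, dX ≫ U.ι = (lift (𝟙 X) (𝟙 X)).left :=
    ⟨IsOpenImmersion.lift U.ι (lift (𝟙 X) (𝟙 X)).left hΔ', IsOpenImmersion.lift_fac _ _ _⟩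
  refine ⟨{ N := Over.mk (U.ι ≫ (X ⊗ X).hom)
            incl := Over.homMk U.ι rfl
            isOpenImmersion_incl := inferInstanceAs (IsOpenImmersion U.ι)
            isClosedImmersion_incl := hUc
            diag := Over.homMk dX (by
                change dX ≫ U.ι ≫ (X ⊗ X).hom = X.hom
                rw [← Category.assoc, hfac]
                exact Over.w (lift (𝟙 X) (𝟙 X)))
            diag_incl := Over.OverMorphism.ext hfac
            minimal := fun W j hjo hjc hδ => ?_ }, hrange⟩
  have hsub : Set.range ⇑U.ι ⊆ Set.range ⇑j.left := hrange.subset.trans (hmin W j hjo hjc hδ)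
  refine ⟨Over.homMk (IsOpenImmersion.lift j.left U.ι hsub) ?_, ?_⟩
  · change IsOpenImmersion.lift j.left U.ι hsub ≫ W.hom = U.ι ≫ (X ⊗ X).hom
    rw [← Over.w j, ← Category.assoc, IsOpenImmersion.lift_fac]
  · exact Over.OverMorphism.ext (IsOpenImmersion.lift_fac _ _ _)

end Constructor

variable {k : Type u} [Field k] (L : Type u) [Field L] [Algebra k L] {X : SchemeOver k}
  (N' : Nabla ((bcFunctor k L).obj X))

/-- `Δ(X_L) ≫ incl ≫ μ = (ΔX)_L` in `(X × X)_L`, for a `∇(X_L)` and the monoidal structure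
isomorphism `μ : X_L × X_L ⥲ (X × X)_L` of the base change (Mathlib `Functor.Monoidal.lift_μ`).
[folklore] -/
private theorem diag_incl_μ :
    N'.diag ≫ N'.incl ≫ Functor.LaxMonoidal.μ (bcFunctor k L) X X =
      (bcFunctor k L).map (lift (𝟙 X) (𝟙 X)) := by
  rw [← Category.assoc, N'.diag_incl, ← Functor.Monoidal.lift_μ, CategoryTheory.Functor.map_id]

/-- The base-changed diagonal `(ΔX)_L` lands in `∇(X_L)` (read in `(X × X)_L`). [folklore] -/
private theorem range_map_diag_subset :
    Set.range ⇑((bcFunctor k L).map (lift (𝟙 X) (𝟙 X))).left ⊆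
      Set.range ⇑(N'.incl ≫ Functor.LaxMonoidal.μ (bcFunctor k L) X X).left := by
  rintro _ ⟨x, rfl⟩
  refine ⟨N'.diag.left x, ?_⟩
  rw [← Scheme.Hom.comp_apply, ← Over.comp_left, diag_incl_μ]

/-- **`∇(X_L)` is contained in the base change of every clopen `k`-subscheme of `X × X` containing
`ΔX`** (minimality of `∇(X_L)`, Def. 2.1 (1), applied to the base change `W_L ↪ (X × X)_L ≅ X_L × X_L`,
again a clopen immersion through which `Δ(X_L) = (ΔX)_L` factors). [cite: Liu2021, §2.1 Def. 2.1 (1), l. 1174] -/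
theorem range_incl_μ_subset_range_map {W : SchemeOver k} (j : W ⟶ X ⊗ X) (hjo : IsOpenImmersion j.left)
    (hjc : IsClosedImmersion j.left) (d : X ⟶ W) (hd : d ≫ j = lift (𝟙 X) (𝟙 X)) :
    Set.range ⇑(N'.incl ≫ Functor.LaxMonoidal.μ (bcFunctor k L) X X).left ⊆
      Set.range ⇑((bcFunctor k L).map j).left := by
  haveI := GaloisDescent.isOpenImmersion_bcFunctor_map_left L j
  haveI := GaloisDescent.isClosedImmersion_bcFunctor_map_left L j
  haveI : IsIso (Functor.OplaxMonoidal.δ (bcFunctor k L) X X).left :=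
    ((Over.forget _).mapIso (Functor.Monoidal.μIso (bcFunctor k L) X X)).isIso_inv
  haveI : IsOpenImmersion ((bcFunctor k L).map j ≫ Functor.OplaxMonoidal.δ (bcFunctor k L) X X).left := by
    rw [Over.comp_left]; infer_instance
  haveI : IsClosedImmersion ((bcFunctor k L).map j ≫ Functor.OplaxMonoidal.δ (bcFunctor k L) X X).left := by
    rw [Over.comp_left]; infer_instance
  have hd' : (bcFunctor k L).map d ≫ ((bcFunctor k L).map j ≫ Functor.OplaxMonoidal.δ (bcFunctor k L) X X) =
      lift (𝟙 _) (𝟙 _) := by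
    rw [← Category.assoc, ← Functor.map_comp, hd, ← Functor.Monoidal.lift_μ, CategoryTheory.Functor.map_id,
      Category.assoc, Functor.Monoidal.μ_δ, Category.comp_id]
  obtain ⟨f, hf⟩ := N'.minimal _ ((bcFunctor k L).map j ≫ Functor.OplaxMonoidal.δ (bcFunctor k L) X X)
    inferInstance inferInstance ⟨_, hd'⟩
  have hincl : N'.incl ≫ Functor.LaxMonoidal.μ (bcFunctor k L) X X = f ≫ (bcFunctor k L).map j := by
    rw [← hf, Category.assoc, Category.assoc, Functor.Monoidal.δ_μ, Category.comp_id]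
  rintro _ ⟨z, rfl⟩
  exact ⟨f.left z, by rw [hincl, Over.comp_left, Scheme.Hom.comp_apply]⟩

/-- **`∇(X_L) ⊆ (X × X)_L` is stable under the Galois automorphisms `1 × Spec σ⁻¹`** (read through
`μ : X_L × X_L ⥲ (X × X)_L`): the preimage of `∇(X_L)` under `1 × Spec σ⁻¹` is an open and closed
`L`-subscheme of `X_L × X_L` through which the diagonal factors (the diagonal being Galois-equivariant,
`GaloisDescent.gal_comp_map_left`), so it contains `∇(X_L)` by minimality (Def. 2.1 (1)).
[cite: Liu2021, §2.1 Def. 2.1 (1), l. 1174] [cite: GortzWedhorn2020, §(14.20)] -/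
theorem mapsTo_gal_range_incl_μ (σ : L ≃ₐ[k] L) :
    Set.MapsTo ⇑(GaloisDescent.gal L (X ⊗ X) σ)
      (Set.range ⇑(N'.incl ≫ Functor.LaxMonoidal.μ (bcFunctor k L) X X).left)
      (Set.range ⇑(N'.incl ≫ Functor.LaxMonoidal.μ (bcFunctor k L) X X).left) := by
  haveI : IsOpenImmersion N'.incl.left := N'.isOpenImmersion_incl
  haveI : IsClosedImmersion N'.incl.left := N'.isClosedImmersion_incl
  haveI : IsIso (Functor.LaxMonoidal.μ (bcFunctor k L) X X).left :=
    ((Over.forget _).mapIso (Functor.Monoidal.μIso (bcFunctor k L) X X)).isIso_hom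
  haveI : IsIso (Functor.OplaxMonoidal.δ (bcFunctor k L) X X).left :=
    ((Over.forget _).mapIso (Functor.Monoidal.μIso (bcFunctor k L) X X)).isIso_inv
  haveI : IsOpenImmersion (N'.incl ≫ Functor.LaxMonoidal.μ (bcFunctor k L) X X).left := by
    rw [Over.comp_left]; infer_instance
  haveI : IsClosedImmersion (N'.incl ≫ Functor.LaxMonoidal.μ (bcFunctor k L) X X).left := by
    rw [Over.comp_left]; infer_instance
  -- the clopen `U := (1 × Spec σ⁻¹)⁻¹ ∇(X_L)` of `(X × X)_L`
  obtain ⟨W', hW'⟩ : ∃ W' : Set ↥(GaloisDescent.bc L (X ⊗ X)),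
      W' = Set.range ⇑(N'.incl ≫ Functor.LaxMonoidal.μ (bcFunctor k L) X X).left := ⟨_, rfl⟩
  have hW'o : IsOpen W' := hW' ▸ IsOpenImmersion.isOpen_range _
  have hW'c : IsClosed W' := hW' ▸ (Scheme.Hom.isClosedEmbedding _).isClosed_range
  let U : (GaloisDescent.bc L (X ⊗ X)).Opens :=
    ⟨⇑(GaloisDescent.gal L (X ⊗ X) σ) ⁻¹' W', hW'o.preimage (GaloisDescent.gal L (X ⊗ X) σ).continuous⟩
  have hUrange : Set.range ⇑U.ι = ⇑(GaloisDescent.gal L (X ⊗ X) σ) ⁻¹' W' := Scheme.Opens.range_ι U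
  haveI : IsClosedImmersion U.ι := IsClosedImmersion.of_isPreimmersion _ (by
    simpa only [hUrange] using hW'c.preimage (GaloisDescent.gal L (X ⊗ X) σ).continuous)
  -- `U` as an `L`-scheme, with its clopen immersion `ιU ≫ δ` into `X_L × X_L`
  obtain ⟨ιU, hιU⟩ : ∃ ιU : Over.mk (U.ι ≫ ((bcFunctor k L).obj (X ⊗ X)).hom) ⟶ (bcFunctor k L).obj (X ⊗ X),
      ιU.left = U.ι := ⟨Over.homMk U.ι rfl, rfl⟩
  haveI : IsOpenImmersion ιU.left := by rw [hιU]; infer_instance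
  haveI : IsOpenImmersion (ιU ≫ Functor.OplaxMonoidal.δ (bcFunctor k L) X X).left := by
    rw [Over.comp_left, hιU]; infer_instance
  haveI : IsClosedImmersion (ιU ≫ Functor.OplaxMonoidal.δ (bcFunctor k L) X X).left := by
    rw [Over.comp_left, hιU]; infer_instance
  -- the diagonal factors through `U` (it is Galois-equivariant and lands in `∇(X_L)`)
  have hΔU' : Set.range ⇑((bcFunctor k L).map (lift (𝟙 X) (𝟙 X))).left ⊆
      ⇑(GaloisDescent.gal L (X ⊗ X) σ) ⁻¹' W' := by
    have E1 : N'.diag.left ≫ (N'.incl ≫ Functor.LaxMonoidal.μ (bcFunctor k L) X X).left =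
        ((bcFunctor k L).map (lift (𝟙 X) (𝟙 X))).left := by
      rw [← Over.comp_left, diag_incl_μ]
    rintro _ ⟨x, rfl⟩
    rw [Set.mem_preimage, hW']
    exact ⟨N'.diag.left (GaloisDescent.gal L X σ x), (GaloisDescent.apply_apply_of_comp_eq E1 _).trans
      (GaloisDescent.apply_apply_of_comp_eq (GaloisDescent.gal_comp_map_left L (lift (𝟙 X) (𝟙 X)) σ) x)⟩
  have hUrange' : Set.range ⇑ιU.left = ⇑(GaloisDescent.gal L (X ⊗ X) σ) ⁻¹' W' := by
    rw [hιU]; exact hUrange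
  have hΔU : Set.range ⇑((bcFunctor k L).map (lift (𝟙 X) (𝟙 X))).left ⊆ Set.range ⇑ιU.left :=
    hΔU'.trans hUrange'.symm.subset
  obtain ⟨dU, hdU⟩ : ∃ dU : ((bcFunctor k L).obj X).left ⟶ (U : Scheme),
      dU ≫ ιU.left = ((bcFunctor k L).map (lift (𝟙 X) (𝟙 X))).left :=
    ⟨IsOpenImmersion.lift ιU.left _ hΔU, IsOpenImmersion.lift_fac _ _ _⟩
  have hdU' : dU ≫ U.ι = ((bcFunctor k L).map (lift (𝟙 X) (𝟙 X))).left := by rw [← hιU]; exact hdU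
  obtain ⟨d, hd⟩ : ∃ d : (bcFunctor k L).obj X ⟶ Over.mk (U.ι ≫ ((bcFunctor k L).obj (X ⊗ X)).hom),
      d ≫ ιU = (bcFunctor k L).map (lift (𝟙 X) (𝟙 X)) :=
    ⟨Over.homMk dU (by
        change dU ≫ U.ι ≫ ((bcFunctor k L).obj (X ⊗ X)).hom = ((bcFunctor k L).obj X).hom
        rw [← Category.assoc, hdU']
        exact Over.w _),
      Over.OverMorphism.ext hdU⟩
  have hd' : d ≫ (ιU ≫ Functor.OplaxMonoidal.δ (bcFunctor k L) X X) = lift (𝟙 _) (𝟙 _) := by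
    rw [← Category.assoc, hd, ← Functor.Monoidal.lift_μ, CategoryTheory.Functor.map_id, Category.assoc,
      Functor.Monoidal.μ_δ, Category.comp_id]
  obtain ⟨f, hf⟩ := N'.minimal _ (ιU ≫ Functor.OplaxMonoidal.δ (bcFunctor k L) X X)
    inferInstance inferInstance ⟨d, hd'⟩
  have hincl : N'.incl ≫ Functor.LaxMonoidal.μ (bcFunctor k L) X X = f ≫ ιU := by
    rw [← hf, Category.assoc, Category.assoc, Functor.Monoidal.δ_μ, Category.comp_id]
  intro z hz
  rw [← hW'] at hz ⊢
  have hzU : z ∈ Set.range ⇑ιU.left := by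
    rw [hW', hincl, Over.comp_left] at hz
    exact GaloisDescent.range_comp_subset_range _ _ hz
  rw [hUrange'] at hzU
  exact hzU

/-- **[Liu2021, §2.1, proof of the Proposition] «`(∇X)_{k'} ≃ ∇_{k'}X'`» — Galois descent of `∇`.**
For a `k`-scheme `X`, a finite Galois extension `L / k` and a `∇(X_L)` of `X_L = X ×_k L` (Def. 2.1 (1)),
there is a `∇X` over `k` whose base change is identified with `∇(X_L)` by an isomorphism of
`L`-schemes carrying `(ΔX)_L` to `Δ(X_L)`.  Proof: `∇(X_L) ⊆ (X × X)_L` is a Galois-stable clopen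
(`mapsTo_gal_range_incl_μ`), hence the preimage of its image `W₀ ⊆ X × X`
(`GaloisDescent.preimage_image_fst_eq`), which is clopen (`(X × X)_L → X × X` is finite, so closed, and
surjective); `(X × X)|_{W₀}` contains `ΔX` and is minimal (`range_incl_μ_subset_range_map`), so it is a
`∇X` (`exists_of_isClopen`), and two open immersions with the same image are isomorphic over it.  Ours.
[cite: Liu2021, §2.1 Def. 2.1 (1) (l. 1171–1174) and proof of the Proposition (l. 1194–1200)]
[cite: GortzWedhorn2020, §(14.20), Def. 14.84] -/
theorem exists_of_nabla_baseChange [FiniteDimensional k L] [IsGalois k L] :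
    ∃ (N : Nabla X) (e : (bcFunctor k L).obj N.N ≅ N'.N), (bcFunctor k L).map N.diag ≫ e.hom = N'.diag := by
  haveI : IsOpenImmersion N'.incl.left := N'.isOpenImmersion_incl
  haveI : IsClosedImmersion N'.incl.left := N'.isClosedImmersion_incl
  haveI : IsIso (Functor.LaxMonoidal.μ (bcFunctor k L) X X).left :=
    ((Over.forget _).mapIso (Functor.Monoidal.μIso (bcFunctor k L) X X)).isIso_hom
  haveI : IsOpenImmersion (N'.incl ≫ Functor.LaxMonoidal.μ (bcFunctor k L) X X).left := by
    rw [Over.comp_left]; infer_instance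
  haveI : IsClosedImmersion (N'.incl ≫ Functor.LaxMonoidal.μ (bcFunctor k L) X X).left := by
    rw [Over.comp_left]; infer_instance
  -- `pr : (X × X)_L → X × X` is finite (closed) and surjective
  haveI : IsFinite (bcSpec k L) :=
    (IsFinite.SpecMap_iff _).mpr (RingHom.finite_algebraMap.mpr inferInstance)
  haveI : IsFinite (pullback.fst (X ⊗ X).hom (bcSpec k L)) :=
    MorphismProperty.pullback_fst _ _ inferInstance
  have hclosed : IsClosedMap ⇑(pullback.fst (X ⊗ X).hom (bcSpec k L)) :=
    (pullback.fst (X ⊗ X).hom (bcSpec k L)).isClosedMap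
  have hsurj : Function.Surjective ⇑(pullback.fst (X ⊗ X).hom (bcSpec k L)) :=
    (pullback.fst (X ⊗ X).hom (bcSpec k L)).surjective
  -- `W' = ∇(X_L)` in `(X × X)_L` and its image `W₀`
  obtain ⟨W', hW'⟩ : ∃ W' : Set ↥(GaloisDescent.bc L (X ⊗ X)),
      W' = Set.range ⇑(N'.incl ≫ Functor.LaxMonoidal.μ (bcFunctor k L) X X).left := ⟨_, rfl⟩
  have hW'o : IsOpen W' := hW' ▸ IsOpenImmersion.isOpen_range _
  have hW'c : IsClosed W' := hW' ▸ (Scheme.Hom.isClosedEmbedding _).isClosed_range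
  have hstab : ∀ γ : L ≃ₐ[k] L, Set.MapsTo ⇑(GaloisDescent.gal L (X ⊗ X) γ) W' W' := fun γ => by
    rw [hW']; exact N'.mapsTo_gal_range_incl_μ L γ
  have hpre := GaloisDescent.preimage_image_fst_eq L (X ⊗ X) W' hstab
  obtain ⟨W₀, hW₀⟩ : ∃ W₀ : Set ↥(X ⊗ X).left,
      W₀ = ⇑(pullback.fst (X ⊗ X).hom (bcSpec k L)) '' W' := ⟨_, rfl⟩
  have hW₀c : IsClosed W₀ := hW₀ ▸ hclosed _ hW'c
  have hcompl : W₀ᶜ = ⇑(pullback.fst (X ⊗ X).hom (bcSpec k L)) '' W'ᶜ := by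
    ext z
    constructor
    · intro hz
      obtain ⟨y, rfl⟩ := hsurj z
      exact ⟨y, fun hy => hz (hW₀ ▸ ⟨y, hy, rfl⟩), rfl⟩
    · rintro ⟨y, hy, rfl⟩ hz
      apply hy
      rw [← hpre]
      rw [hW₀] at hz
      exact hz
  have hW₀o : IsOpen W₀ := by
    rw [← compl_compl W₀, hcompl, isOpen_compl_iff]
    exact hclosed _ hW'o.isClosed_compl
  -- the diagonal of `X` lands in `W₀`
  have hΔ : Set.range ⇑(lift (𝟙 X) (𝟙 X)).left ⊆ W₀ := by
    rintro _ ⟨x, rfl⟩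
    obtain ⟨x', hx'⟩ := (pullback.fst X.hom (bcSpec k L)).surjective x
    rw [hW₀]
    refine ⟨((bcFunctor k L).map (lift (𝟙 X) (𝟙 X))).left x', ?_, ?_⟩
    · rw [hW']; exact N'.range_map_diag_subset L ⟨_, rfl⟩
    · rw [← hx']
      exact GaloisDescent.apply_apply_of_comp_eq
        (GaloisDescent.bcFunctor_map_left_comp_fst L (lift (𝟙 X) (𝟙 X))) x'
  -- minimality
  have hmin : ∀ (W : SchemeOver k) (j : W ⟶ X ⊗ X), IsOpenImmersion j.left → IsClosedImmersion j.left →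
      (∃ δ : X ⟶ W, δ ≫ j = lift (𝟙 X) (𝟙 X)) → W₀ ⊆ Set.range ⇑j.left := by
    rintro W j hjo hjc ⟨d, hd⟩
    have h1 : W' ⊆ Set.range ⇑((bcFunctor k L).map j).left := by
      rw [hW']; exact N'.range_incl_μ_subset_range_map L j hjo hjc d hd
    rw [hW₀]
    rintro _ ⟨y, hy, rfl⟩
    obtain ⟨t, rfl⟩ := h1 hy
    exact ⟨pullback.fst W.hom (bcSpec k L) t,
      (GaloisDescent.apply_apply_of_comp_eq (GaloisDescent.bcFunctor_map_left_comp_fst L j) t).symm⟩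
  obtain ⟨N, hN⟩ := exists_of_isClopen X W₀ ⟨hW₀c, hW₀o⟩ hΔ hmin
  -- the isomorphism `N_L ≅ ∇(X_L)`: two open immersions into `(X × X)_L` with the same image
  haveI : IsOpenImmersion N.incl.left := N.isOpenImmersion_incl
  haveI : IsOpenImmersion ((bcFunctor k L).map N.incl).left :=
    GaloisDescent.isOpenImmersion_bcFunctor_map_left L N.incl
  have hrange : Set.range ⇑((bcFunctor k L).map N.incl).left =
      Set.range ⇑(N'.incl ≫ Functor.LaxMonoidal.μ (bcFunctor k L) X X).left := by
    rw [GaloisDescent.range_bcFunctor_map_left, hN, hW₀, hpre, hW']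
  have he₀ := IsOpenImmersion.isoOfRangeEq_hom_fac ((bcFunctor k L).map N.incl).left
    (N'.incl ≫ Functor.LaxMonoidal.μ (bcFunctor k L) X X).left hrange
  have hw : (IsOpenImmersion.isoOfRangeEq ((bcFunctor k L).map N.incl).left
      (N'.incl ≫ Functor.LaxMonoidal.μ (bcFunctor k L) X X).left hrange).hom ≫ N'.N.hom =
      ((bcFunctor k L).obj N.N).hom := by
    rw [← Over.w (N'.incl ≫ Functor.LaxMonoidal.μ (bcFunctor k L) X X), ← Category.assoc, he₀]
    exact Over.w _
  refine ⟨N, Over.isoMk (IsOpenImmersion.isoOfRangeEq ((bcFunctor k L).map N.incl).left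
    (N'.incl ≫ Functor.LaxMonoidal.μ (bcFunctor k L) X X).left hrange) hw, ?_⟩
  haveI : Mono (N'.incl ≫ Functor.LaxMonoidal.μ (bcFunctor k L) X X) := Over.mono_of_mono_left _
  rw [← cancel_mono (N'.incl ≫ Functor.LaxMonoidal.μ (bcFunctor k L) X X), Category.assoc]
  have h1 : (Over.isoMk (IsOpenImmersion.isoOfRangeEq ((bcFunctor k L).map N.incl).left
      (N'.incl ≫ Functor.LaxMonoidal.μ (bcFunctor k L) X X).left hrange) hw).hom ≫
      (N'.incl ≫ Functor.LaxMonoidal.μ (bcFunctor k L) X X) = (bcFunctor k L).map N.incl :=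
    Over.OverMorphism.ext he₀
  rw [h1, ← Functor.map_comp, N.diag_incl, ← Category.assoc, N'.diag_incl, ← Functor.Monoidal.lift_μ,
    CategoryTheory.Functor.map_id]

/-- **Galois descent of `∇`, WITH the compatibility of the comparison isomorphism with the inclusions.**
Same statement and construction as `exists_of_nabla_baseChange` — for a finite Galois `L / k` and a `∇(X_L)`
there is a `∇X` over `k` with `(∇X)_L ≅ ∇(X_L)` — recording in addition that the isomorphism lies OVER
`(X × X)_L ≅ X_L × X_L`: `e ≫ (∇(X_L) ↪ X_L × X_L ⥲ (X × X)_L) = (∇X ↪ X × X)_L` (it is Mathlib's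
`IsOpenImmersion.isoOfRangeEq` of two open immersions with the same image), so that `e` carries the base change
of a `T`-point of `∇X` over `(a, b)` to a `T_L`-point of `∇(X_L)` over `(a_L, b_L)`; the diagonal compatibility
follows.  Needed to transport the cocycle identity of Albanese morphisms (`AppendixC/AlbaneseCocycle.lean`) along
base change.  Ours. [cite: Liu2021, §2.1 Def. 2.1 (1) (l. 1171–1174) and proof of the Proposition (l. 1194–1200)]
[cite: GortzWedhorn2020, §(14.20), Def. 14.84] -/
theorem exists_of_nabla_baseChange_incl [FiniteDimensional k L] [IsGalois k L] :
    ∃ (N : Nabla X) (e : (bcFunctor k L).obj N.N ≅ N'.N),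
      e.hom ≫ N'.incl ≫ Functor.LaxMonoidal.μ (bcFunctor k L) X X = (bcFunctor k L).map N.incl ∧
        (bcFunctor k L).map N.diag ≫ e.hom = N'.diag := by
  haveI : IsOpenImmersion N'.incl.left := N'.isOpenImmersion_incl
  haveI : IsClosedImmersion N'.incl.left := N'.isClosedImmersion_incl
  haveI : IsIso (Functor.LaxMonoidal.μ (bcFunctor k L) X X).left :=
    ((Over.forget _).mapIso (Functor.Monoidal.μIso (bcFunctor k L) X X)).isIso_hom
  haveI : IsOpenImmersion (N'.incl ≫ Functor.LaxMonoidal.μ (bcFunctor k L) X X).left := by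
    rw [Over.comp_left]; infer_instance
  haveI : IsClosedImmersion (N'.incl ≫ Functor.LaxMonoidal.μ (bcFunctor k L) X X).left := by
    rw [Over.comp_left]; infer_instance
  -- `pr : (X × X)_L → X × X` is finite (closed) and surjective
  haveI : IsFinite (bcSpec k L) :=
    (IsFinite.SpecMap_iff _).mpr (RingHom.finite_algebraMap.mpr inferInstance)
  haveI : IsFinite (pullback.fst (X ⊗ X).hom (bcSpec k L)) :=
    MorphismProperty.pullback_fst _ _ inferInstance
  have hclosed : IsClosedMap ⇑(pullback.fst (X ⊗ X).hom (bcSpec k L)) :=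
    (pullback.fst (X ⊗ X).hom (bcSpec k L)).isClosedMap
  have hsurj : Function.Surjective ⇑(pullback.fst (X ⊗ X).hom (bcSpec k L)) :=
    (pullback.fst (X ⊗ X).hom (bcSpec k L)).surjective
  -- `W' = ∇(X_L)` in `(X × X)_L` and its image `W₀`
  obtain ⟨W', hW'⟩ : ∃ W' : Set ↥(GaloisDescent.bc L (X ⊗ X)),
      W' = Set.range ⇑(N'.incl ≫ Functor.LaxMonoidal.μ (bcFunctor k L) X X).left := ⟨_, rfl⟩
  have hW'o : IsOpen W' := hW' ▸ IsOpenImmersion.isOpen_range _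
  have hW'c : IsClosed W' := hW' ▸ (Scheme.Hom.isClosedEmbedding _).isClosed_range
  have hstab : ∀ γ : L ≃ₐ[k] L, Set.MapsTo ⇑(GaloisDescent.gal L (X ⊗ X) γ) W' W' := fun γ => by
    rw [hW']; exact N'.mapsTo_gal_range_incl_μ L γ
  have hpre := GaloisDescent.preimage_image_fst_eq L (X ⊗ X) W' hstab
  obtain ⟨W₀, hW₀⟩ : ∃ W₀ : Set ↥(X ⊗ X).left,
      W₀ = ⇑(pullback.fst (X ⊗ X).hom (bcSpec k L)) '' W' := ⟨_, rfl⟩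
  have hW₀c : IsClosed W₀ := hW₀ ▸ hclosed _ hW'c
  have hcompl : W₀ᶜ = ⇑(pullback.fst (X ⊗ X).hom (bcSpec k L)) '' W'ᶜ := by
    ext z
    constructor
    · intro hz
      obtain ⟨y, rfl⟩ := hsurj z
      exact ⟨y, fun hy => hz (hW₀ ▸ ⟨y, hy, rfl⟩), rfl⟩
    · rintro ⟨y, hy, rfl⟩ hz
      apply hy
      rw [← hpre]
      rw [hW₀] at hz
      exact hz
  have hW₀o : IsOpen W₀ := by
    rw [← compl_compl W₀, hcompl, isOpen_compl_iff]
    exact hclosed _ hW'o.isClosed_compl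
  -- the diagonal of `X` lands in `W₀`
  have hΔ : Set.range ⇑(lift (𝟙 X) (𝟙 X)).left ⊆ W₀ := by
    rintro _ ⟨x, rfl⟩
    obtain ⟨x', hx'⟩ := (pullback.fst X.hom (bcSpec k L)).surjective x
    rw [hW₀]
    refine ⟨((bcFunctor k L).map (lift (𝟙 X) (𝟙 X))).left x', ?_, ?_⟩
    · rw [hW']; exact N'.range_map_diag_subset L ⟨_, rfl⟩
    · rw [← hx']
      exact GaloisDescent.apply_apply_of_comp_eq
        (GaloisDescent.bcFunctor_map_left_comp_fst L (lift (𝟙 X) (𝟙 X))) x'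
  -- minimality
  have hmin : ∀ (W : SchemeOver k) (j : W ⟶ X ⊗ X), IsOpenImmersion j.left → IsClosedImmersion j.left →
      (∃ δ : X ⟶ W, δ ≫ j = lift (𝟙 X) (𝟙 X)) → W₀ ⊆ Set.range ⇑j.left := by
    rintro W j hjo hjc ⟨d, hd⟩
    have h1 : W' ⊆ Set.range ⇑((bcFunctor k L).map j).left := by
      rw [hW']; exact N'.range_incl_μ_subset_range_map L j hjo hjc d hd
    rw [hW₀]
    rintro _ ⟨y, hy, rfl⟩
    obtain ⟨t, rfl⟩ := h1 hy
    exact ⟨pullback.fst W.hom (bcSpec k L) t,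
      (GaloisDescent.apply_apply_of_comp_eq (GaloisDescent.bcFunctor_map_left_comp_fst L j) t).symm⟩
  obtain ⟨N, hN⟩ := exists_of_isClopen X W₀ ⟨hW₀c, hW₀o⟩ hΔ hmin
  -- the isomorphism `N_L ≅ ∇(X_L)`: two open immersions into `(X × X)_L` with the same image
  haveI : IsOpenImmersion N.incl.left := N.isOpenImmersion_incl
  haveI : IsOpenImmersion ((bcFunctor k L).map N.incl).left :=
    GaloisDescent.isOpenImmersion_bcFunctor_map_left L N.incl
  have hrange : Set.range ⇑((bcFunctor k L).map N.incl).left =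
      Set.range ⇑(N'.incl ≫ Functor.LaxMonoidal.μ (bcFunctor k L) X X).left := by
    rw [GaloisDescent.range_bcFunctor_map_left, hN, hW₀, hpre, hW']
  have he₀ := IsOpenImmersion.isoOfRangeEq_hom_fac ((bcFunctor k L).map N.incl).left
    (N'.incl ≫ Functor.LaxMonoidal.μ (bcFunctor k L) X X).left hrange
  have hw : (IsOpenImmersion.isoOfRangeEq ((bcFunctor k L).map N.incl).left
      (N'.incl ≫ Functor.LaxMonoidal.μ (bcFunctor k L) X X).left hrange).hom ≫ N'.N.hom =
      ((bcFunctor k L).obj N.N).hom := by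
    rw [← Over.w (N'.incl ≫ Functor.LaxMonoidal.μ (bcFunctor k L) X X), ← Category.assoc, he₀]
    exact Over.w _
  refine ⟨N, Over.isoMk (IsOpenImmersion.isoOfRangeEq ((bcFunctor k L).map N.incl).left
    (N'.incl ≫ Functor.LaxMonoidal.μ (bcFunctor k L) X X).left hrange) hw, Over.OverMorphism.ext he₀, ?_⟩
  haveI : Mono (N'.incl ≫ Functor.LaxMonoidal.μ (bcFunctor k L) X X) := Over.mono_of_mono_left _
  rw [← cancel_mono (N'.incl ≫ Functor.LaxMonoidal.μ (bcFunctor k L) X X), Category.assoc]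
  have h1 : (Over.isoMk (IsOpenImmersion.isoOfRangeEq ((bcFunctor k L).map N.incl).left
      (N'.incl ≫ Functor.LaxMonoidal.μ (bcFunctor k L) X X).left hrange) hw).hom ≫
      (N'.incl ≫ Functor.LaxMonoidal.μ (bcFunctor k L) X X) = (bcFunctor k L).map N.incl :=
    Over.OverMorphism.ext he₀
  rw [h1, ← Functor.map_comp, N.diag_incl, ← Category.assoc, N'.diag_incl, ← Functor.Monoidal.lift_μ,
    CategoryTheory.Functor.map_id]

end Nabla

end Literature.NumberTheory.Automorphic.Liu2021.AppendixC

end
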